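import Literature.Analysis.FluidPDE.MillerMiddleEigenvalueSup
import HarnessLib

/-!
# Miller's enstrophy production bound with an `L^∞` majorant of the middle principal strain —
# the SHARP constant (Neustupa–Penel 2001 / Miller 2019, endpoint `q = ∞`)

Analysis/FluidPDE proofs file (theorems only).  The tree's endpoint slice bound
`integral_sum_inner_fderiv_le_of_momentum_of_midStrain_le` (`MillerMiddleEigenvalueSup.lean`) reads
`∫ Σᵢ ⟪∂ᵢv, ∂ᵢW⟫ ≤ −ν ∫‖Δv‖² + 2 M₀ ∫ |∇v|²_F` for a pointwise majorant `M₀` of `λ₂(∇v(x))`; its constant `2` comes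
from the tree's pointwise Lemma 5.1 (`neg_sum_inner_apply_apply_le_midStrain`), which weakens Miller's
`2 λ₂⁺ |S|²_F` to `2 λ₂⁺ |∇v|²_F` (`|S|_F ≤ |∇v|_F`).  This file restores Miller's sharp constant:

* `neg_sum_inner_apply_apply_le_midStrain_sharp` — for a trace-free linear map `L` of `ℝ³`,
  `−Σⱼ ⟪L eⱼ, L (L eⱼ)⟫ ≤ λ₂⁺(L) (|L|²_F + tr (L ∘ L)) + det L`, where `|L|²_F + tr (L ∘ L) = 2 |S|²_F`,
  `S = ½ (L + Lᵀ)` (`frobeniusNormSq_add_traceCLM_comp_eq`: it equals `½ Σᵢⱼ (Lᵢⱼ + Lⱼᵢ)²`, hence is `≥ 0`);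
* `integral_sum_inner_fderiv_le_of_momentum_of_midStrain_le_sharp` —
  `∫ Σᵢ ⟪∂ᵢv, ∂ᵢW⟫ ≤ −ν ∫‖Δv‖² + M₀ ∫ |∇v|²_F`
  (Steps 1–5 of the tree's proof verbatim; then `∫ det ∇v = 0`, `λ₂⁺ ≤ M₀` against the NONNEGATIVE density
  `|∇v|²_F + tr (∇v ∘ ∇v)`, and the global `div`–`curl` identity in the form
  `∫ tr (∇v ∘ ∇v) = ∫ |∇v|²_F − ∫ ‖curl v‖² ≤ 0` (`frobeniusNormSq_fderiv_eq_sq_norm_curl_add_trace`,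
  `lintegral_frobeniusNormSq_fderiv_le_lintegral_sq_norm_curl`), i.e. Miller's `∫|∇v|² = 2∫|S|²`; this is where the
  extra hypothesis `v ∈ L²` enters).

With `M₀ = ε/(T−t)` this is the Grönwall density `2ε/(T−t)` for the enstrophy (`∂ₜ‖∇u‖² ≤ 2 λ₂⁺ ‖∇u‖²`), i.e. the
sharp threshold `ε < 1/4` of the cell nsreg-p1 ROUND-15 rung (ii) (`MillerMiddleEigenvalueSupGronwallSharp`).

References: Miller, ARMA 235 (2020) = arXiv:1710.05569, Thm 1.1, Lemma 5.1, Prop. 3.1 (`‖S‖² = ½‖∇⊗u‖²`,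
arXiv numbering) [Miller2019]; Neustupa–Penel 2001, Thm 2 [NeustupaPenel2001].
-/

noncomputable section
open MeasureTheory Set Function Filter Topology InnerProductSpace
open scoped ENNReal NNReal ContDiff RealInnerProductSpace Laplacian Matrix

namespace Literature.Analysis.FluidPDE

/-! ### Pointwise: the sharp production bound -/

/-- `tr (L ∘ L) = Σᵢⱼ Gᵢⱼ Gⱼᵢ` for the standard matrix `G` of `L`. [folklore] -/
private theorem traceCLM_comp_self_eq_sum_stdMatrix
    (L : EuclideanSpace ℝ (Fin 3) →L[ℝ] EuclideanSpace ℝ (Fin 3)) :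
    traceCLM (L.comp L) =
      ∑ i, ∑ j, stdMatrix (L : EuclideanSpace ℝ (Fin 3) →ₗ[ℝ] EuclideanSpace ℝ (Fin 3)) i j *
        stdMatrix (L : EuclideanSpace ℝ (Fin 3) →ₗ[ℝ] EuclideanSpace ℝ (Fin 3)) j i := by
  have hcoe : ((L.comp L : EuclideanSpace ℝ (Fin 3) →L[ℝ] EuclideanSpace ℝ (Fin 3)) :
      EuclideanSpace ℝ (Fin 3) →ₗ[ℝ] EuclideanSpace ℝ (Fin 3)) =
      (L : EuclideanSpace ℝ (Fin 3) →ₗ[ℝ] EuclideanSpace ℝ (Fin 3)) ∘ₗ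
        (L : EuclideanSpace ℝ (Fin 3) →ₗ[ℝ] EuclideanSpace ℝ (Fin 3)) := rfl
  rw [traceCLM_apply, hcoe, ← trace_stdMatrix, stdMatrix_comp]
  simp only [Matrix.trace, Matrix.diag, Matrix.mul_apply]

/-- **`|L|²_F + tr (L ∘ L) = ½ Σᵢⱼ (Gᵢⱼ + Gⱼᵢ)²` = `2 |S|²_F`** (`S = ½(G + Gᵀ)` the symmetric part of the
standard matrix `G` of `L`). [folklore] -/
private theorem frobeniusNormSq_add_traceCLM_comp_eq
    (L : EuclideanSpace ℝ (Fin 3) →L[ℝ] EuclideanSpace ℝ (Fin 3)) :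
    FluidPDE.frobeniusNormSq L + traceCLM (L.comp L) =
      2⁻¹ * ∑ i, ∑ j, (stdMatrix (L : EuclideanSpace ℝ (Fin 3) →ₗ[ℝ] EuclideanSpace ℝ (Fin 3)) i j +
        stdMatrix (L : EuclideanSpace ℝ (Fin 3) →ₗ[ℝ] EuclideanSpace ℝ (Fin 3)) j i) ^ 2 := by
  rw [frobeniusNormSq_eq_sum_sq_stdMatrix L, traceCLM_comp_self_eq_sum_stdMatrix]
  simp only [Fin.sum_univ_three]
  ring

/-- `0 ≤ |L|²_F + tr (L ∘ L)` (`= 2 |S|²_F`). [folklore] -/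
private theorem frobeniusNormSq_add_traceCLM_comp_nonneg
    (L : EuclideanSpace ℝ (Fin 3) →L[ℝ] EuclideanSpace ℝ (Fin 3)) :
    0 ≤ FluidPDE.frobeniusNormSq L + traceCLM (L.comp L) := by
  rw [frobeniusNormSq_add_traceCLM_comp_eq]
  exact mul_nonneg (by norm_num)
    (Finset.sum_nonneg fun i _ => Finset.sum_nonneg fun j _ => sq_nonneg _)

/-- `−|L|²_F ≤ tr (L ∘ L) ≤ |L|²_F`, second half: `tr (L ∘ L) ≤ |L|²_F` (`|L|²_F − tr(L∘L) = ½ Σ (Gᵢⱼ − Gⱼᵢ)²`).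
[folklore] -/
private theorem traceCLM_comp_le_frobeniusNormSq
    (L : EuclideanSpace ℝ (Fin 3) →L[ℝ] EuclideanSpace ℝ (Fin 3)) :
    traceCLM (L.comp L) ≤ FluidPDE.frobeniusNormSq L := by
  rw [frobeniusNormSq_eq_sum_sq_stdMatrix L, traceCLM_comp_self_eq_sum_stdMatrix]
  set G := stdMatrix (L : EuclideanSpace ℝ (Fin 3) →ₗ[ℝ] EuclideanSpace ℝ (Fin 3)) with hG
  simp only [Fin.sum_univ_three]
  nlinarith [sq_nonneg (G 0 1 - G 1 0), sq_nonneg (G 0 2 - G 2 0), sq_nonneg (G 1 2 - G 2 1)]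

/-- The production–determinant identity for a trace-free `3 × 3` array `G`:
`Σ_{ijk} Gᵢⱼ Gᵢₖ Gₖⱼ = ½ det (G + Gᵀ) − det G` (Betchov 1956). [cite: Miller2019, Lemma 5.1 (with Prop. 4.8)] -/
private theorem stretch_eq_half_det_add_transpose_sub_det' (G : Fin 3 → Fin 3 → ℝ)
    (htr : ∑ i, G i i = 0) :
    ∑ i, ∑ j, ∑ k, G i j * G i k * G k j =
      2⁻¹ * Matrix.det (Matrix.of fun i j => G i j + G j i) - Matrix.det (Matrix.of fun i j => G i j) := by
  rw [Matrix.det_fin_three, Matrix.det_fin_three]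
  simp only [Fin.sum_univ_three, Matrix.of_apply] at htr ⊢
  have h00 : G 0 0 = -(G 1 1 + G 2 2) := by linarith
  rw [h00]
  ring

/-- `Σⱼ ⟪L eⱼ, L (L eⱼ)⟫ = Σ_{ijk} Gᵢⱼ Gᵢₖ Gₖⱼ` in the standard matrix `G` of `L`. [folklore] -/
private theorem sum_inner_apply_apply_eq_sum'
    (L : EuclideanSpace ℝ (Fin 3) →L[ℝ] EuclideanSpace ℝ (Fin 3)) :
    ∑ j, ⟪L (EuclideanSpace.basisFun (Fin 3) ℝ j), L (L (EuclideanSpace.basisFun (Fin 3) ℝ j))⟫_ℝ =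
      ∑ i, ∑ j, ∑ k,
        stdMatrix (L : EuclideanSpace ℝ (Fin 3) →ₗ[ℝ] EuclideanSpace ℝ (Fin 3)) i j *
        stdMatrix (L : EuclideanSpace ℝ (Fin 3) →ₗ[ℝ] EuclideanSpace ℝ (Fin 3)) i k *
        stdMatrix (L : EuclideanSpace ℝ (Fin 3) →ₗ[ℝ] EuclideanSpace ℝ (Fin 3)) k j := by
  set e := EuclideanSpace.basisFun (Fin 3) ℝ with he
  have hG : ∀ i j, stdMatrix (L : EuclideanSpace ℝ (Fin 3) →ₗ[ℝ] EuclideanSpace ℝ (Fin 3)) i j =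
      (L (e j)) i := fun i j => by
    rw [stdMatrix_apply, ContinuousLinearMap.coe_coe, he, EuclideanSpace.basisFun_apply]
  have hexp : ∀ w : EuclideanSpace ℝ (Fin 3), L w = ∑ k, w k • L (e k) := by
    intro w
    conv_lhs => rw [← (EuclideanSpace.basisFun (Fin 3) ℝ).sum_repr' w]
    simp [map_sum, map_smul, he, EuclideanSpace.inner_single_left]
  have hinner : ∀ x y : EuclideanSpace ℝ (Fin 3), ⟪x, y⟫_ℝ = ∑ i, x i * y i := by
    intro x y
    rw [EuclideanSpace.inner_eq_star_dotProduct, dotProduct]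
    simp [mul_comm]
  simp_rw [hG]
  calc ∑ j, ⟪L (e j), L (L (e j))⟫_ℝ
      = ∑ j, ∑ k, (L (e j)) k * ⟪L (e j), L (e k)⟫_ℝ := by
        refine Finset.sum_congr rfl fun j _ => ?_
        conv_lhs => rw [hexp (L (e j))]
        rw [inner_sum]
        exact Finset.sum_congr rfl fun k _ => by rw [real_inner_smul_right]
    _ = ∑ j, ∑ k, (L (e j)) k * ∑ i, (L (e j)) i * (L (e k)) i := by
        simp_rw [hinner]
    _ = ∑ j, ∑ i, ∑ k, (L (e j)) i * (L (e k)) i * (L (e j)) k := by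
        refine Finset.sum_congr rfl fun j _ => ?_
        rw [Finset.sum_comm]
        refine Finset.sum_congr rfl fun i _ => ?_
        rw [Finset.mul_sum]
        refine Finset.sum_congr rfl fun k _ => by ring
    _ = ∑ i, ∑ j, ∑ k, (L (e j)) i * (L (e k)) i * (L (e j)) k := Finset.sum_comm

/-- **The SHARP pointwise production bound via the middle principal strain** (Miller 2020, Lemma 5.1
`−det S ≤ ½|S|²λ₂⁺` with the algebra `Σⱼ⟪L eⱼ, L(L eⱼ)⟫ = ½ det(G + Gᵀ) − det G` for a trace-free `L` with
matrix `G`, WITHOUT the weakening `|S|_F ≤ |G|_F`): for a trace-free linear map `L` of `ℝ³`,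
`−Σⱼ ⟪L eⱼ, L (L eⱼ)⟫ ≤ λ₂⁺(L) (|L|²_F + tr (L ∘ L)) + det L` (and `|L|²_F + tr (L ∘ L) = 2|S|²_F`).
[cite: Miller2019, Lemma 5.1] -/
theorem neg_sum_inner_apply_apply_le_midStrain_sharp
    (L : EuclideanSpace ℝ (Fin 3) →L[ℝ] EuclideanSpace ℝ (Fin 3))
    (htr : LinearMap.trace ℝ (EuclideanSpace ℝ (Fin 3))
      (L : EuclideanSpace ℝ (Fin 3) →ₗ[ℝ] EuclideanSpace ℝ (Fin 3)) = 0) :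
    -∑ j, ⟪L (EuclideanSpace.basisFun (Fin 3) ℝ j), L (L (EuclideanSpace.basisFun (Fin 3) ℝ j))⟫_ℝ ≤
      max (strainEigenvalues (L : EuclideanSpace ℝ (Fin 3) →ₗ[ℝ] EuclideanSpace ℝ (Fin 3))
          finrank_euclideanSpace_fin 1) 0 * (FluidPDE.frobeniusNormSq L + traceCLM (L.comp L)) +
        LinearMap.det (L : EuclideanSpace ℝ (Fin 3) →ₗ[ℝ] EuclideanSpace ℝ (Fin 3)) := by
  set Ll : EuclideanSpace ℝ (Fin 3) →ₗ[ℝ] EuclideanSpace ℝ (Fin 3) := ↑L with hLl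
  set G : Matrix (Fin 3) (Fin 3) ℝ := stdMatrix Ll with hGdef
  -- trace-free matrix
  have htrG : ∑ i, G i i = 0 := by
    have h := trace_stdMatrix Ll
    rw [htr] at h
    simpa [Matrix.trace, Matrix.diag, hGdef] using h
  -- the production density in coordinates, and the determinant identity
  have hU : ∑ j, ⟪L (EuclideanSpace.basisFun (Fin 3) ℝ j), L (L (EuclideanSpace.basisFun (Fin 3) ℝ j))⟫_ℝ
      = ∑ i, ∑ j, ∑ k, G i j * G i k * G k j := sum_inner_apply_apply_eq_sum' L
  have hid := stretch_eq_half_det_add_transpose_sub_det' G htrG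
  have hofG : (Matrix.of fun i j => G i j) = G := by ext i j; rfl
  have hdetG : Matrix.det G = LinearMap.det Ll := LinearMap.det_toMatrix _ Ll
  -- the symmetric matrix `M = G + Gᵀ` and Miller's Lemma 5.1
  set M : Matrix (Fin 3) (Fin 3) ℝ := stdMatrix Ll + (stdMatrix Ll)ᴴ with hMdef
  have hMH : M.IsHermitian := Matrix.isHermitian_add_transpose_self _
  have hsym : M.IsSymm := Matrix.isHermitian_iff_isSymm.1 hMH
  have hMij : ∀ i j, M i j = G i j + G j i := fun i j => by
    simp [hMdef, hGdef, Matrix.add_apply]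
  have htrM : M.trace = 0 := by
    simp only [Matrix.trace, Matrix.diag, hMij]
    rw [Finset.sum_add_distrib, htrG, add_zero]
  have hofM : (Matrix.of fun i j => G i j + G j i) = M := by
    ext i j; rw [Matrix.of_apply, hMij]
  have hmil := Miller2019.neg_det_le_half_normSq_mul_posPart_middleEigenvalue
    (Fintype.card_fin 3) M hsym htrM
  -- the eigenvalue in Miller's lemma is `2 λ₂(L)`
  have hbridge : (Matrix.isHermitian_iff_isSymm.mpr hsym).eigenvalues₀
      (Fin.cast (Fintype.card_fin 3).symm 1) = 2 * strainEigenvalues Ll finrank_euclideanSpace_fin 1 := by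
    rw [strainEigenvalues_eq_eigenvalues₀ Ll 1]
    have hpi : (Matrix.isHermitian_iff_isSymm.mpr hsym).eigenvalues₀ =
        (Matrix.isHermitian_add_transpose_self (stdMatrix Ll)).eigenvalues₀ := rfl
    rw [hpi]
    ring
  rw [hbridge] at hmil
  -- `Σ M² = 2 (|L|²_F + tr (L ∘ L))` (no weakening)
  have hfro : ∑ i, ∑ j, M i j ^ 2 = 2 * (FluidPDE.frobeniusNormSq L + traceCLM (L.comp L)) := by
    rw [frobeniusNormSq_add_traceCLM_comp_eq L]
    simp only [hMij]
    ring
  have hmax : max (2 * strainEigenvalues Ll finrank_euclideanSpace_fin 1) 0 =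
      2 * max (strainEigenvalues Ll finrank_euclideanSpace_fin 1) 0 := by
    rcases le_total 0 (strainEigenvalues Ll finrank_euclideanSpace_fin 1) with h | h
    · rw [max_eq_left h, max_eq_left (by linarith)]
    · rw [max_eq_right h, max_eq_right (by linarith), mul_zero]
  rw [hmax, hfro] at hmil
  -- assemble
  rw [hU, hid, hofG, hofM, hdetG]
  nlinarith [hmil]

/-! ### The sharp slice bound -/

/-- `‖∇vᵢ(y)‖ ≤ ‖Dv(y)‖` for the coordinate gradients of a differentiable field. [folklore] -/
private theorem norm_gradient_coord_le_norm_fderiv''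
    {v : EuclideanSpace ℝ (Fin 3) → EuclideanSpace ℝ (Fin 3)} {y : EuclideanSpace ℝ (Fin 3)}
    (hd : DifferentiableAt ℝ v y) (i : Fin 3) :
    ‖gradient (fun z => v z i) y‖ ≤ ‖fderiv ℝ v y‖ := by
  set w := gradient (fun z => v z i) y with hw
  have h1 : ‖w‖ ^ 2 ≤ ‖fderiv ℝ v y‖ * ‖w‖ := by
    rw [← real_inner_self_eq_norm_sq, hw, inner_gradient_coord_eq hd i]
    calc fderiv ℝ v y (gradient (fun z => v z i) y) i
        ≤ |fderiv ℝ v y (gradient (fun z => v z i) y) i| := le_abs_self _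
      _ ≤ ‖fderiv ℝ v y (gradient (fun z => v z i) y)‖ := by
          simpa [Real.norm_eq_abs] using
            PiLp.norm_apply_le (fderiv ℝ v y (gradient (fun z => v z i) y)) i
      _ ≤ ‖fderiv ℝ v y‖ * ‖gradient (fun z => v z i) y‖ := (fderiv ℝ v y).le_opNorm _
  by_cases hw0 : ‖w‖ = 0
  · rw [hw0]; exact norm_nonneg _
  · exact le_of_mul_le_mul_right (by nlinarith [h1]) (lt_of_le_of_ne (norm_nonneg _) (Ne.symm hw0))

/-- Hadamard-type bound `|det Dv(y)| ≤ ½ ‖Dv(y)‖ |Dv(y)|²_F`. [folklore] -/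
private theorem abs_det_fderiv_le''
    {v : EuclideanSpace ℝ (Fin 3) → EuclideanSpace ℝ (Fin 3)} {y : EuclideanSpace ℝ (Fin 3)}
    (hd : DifferentiableAt ℝ v y) :
    |LinearMap.det (fderiv ℝ v y : EuclideanSpace ℝ (Fin 3) →ₗ[ℝ] EuclideanSpace ℝ (Fin 3))| ≤
      1 / 2 * ‖fderiv ℝ v y‖ * FluidPDE.frobeniusNormSq (fderiv ℝ v y) := by
  rw [det_fderiv_eq_inner_gradient_cross hd]
  set g0 := gradient (fun z => v z 0) y
  set g1 := gradient (fun z => v z 1) y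
  set g2 := gradient (fun z => v z 2) y
  have hcross : ‖cross g1 g2‖ ≤ ‖g1‖ * ‖g2‖ := by
    rw [norm_cross]
    exact mul_le_of_le_one_right (by positivity) (Real.sin_le_one _)
  have hF := frobeniusNormSq_fderiv_eq_sum_norm_gradient_sq hd
  have hgg : ‖g1‖ * ‖g2‖ ≤ (1 / 2) * FluidPDE.frobeniusNormSq (fderiv ℝ v y) := by
    rw [hF]
    nlinarith [sq_nonneg (‖g1‖ - ‖g2‖), sq_nonneg ‖g0‖]
  calc |⟪g0, cross g1 g2⟫_ℝ| ≤ ‖g0‖ * ‖cross g1 g2‖ := abs_real_inner_le_norm _ _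
    _ ≤ ‖fderiv ℝ v y‖ * (‖g1‖ * ‖g2‖) :=
        mul_le_mul (norm_gradient_coord_le_norm_fderiv'' hd 0) hcross (norm_nonneg _) (norm_nonneg _)
    _ ≤ ‖fderiv ℝ v y‖ * ((1 / 2) * FluidPDE.frobeniusNormSq (fderiv ℝ v y)) :=
        mul_le_mul_of_nonneg_left hgg (norm_nonneg _)
    _ = 1 / 2 * ‖fderiv ℝ v y‖ * FluidPDE.frobeniusNormSq (fderiv ℝ v y) := by ring

/-- `|∇v|²_F` is integrable for a `C¹` field with `Dv ∈ L²`. [folklore] -/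
private theorem integrable_frobeniusNormSq_fderiv''
    {v : EuclideanSpace ℝ (Fin 3) → EuclideanSpace ℝ (Fin 3)} (hv : ContDiff ℝ 1 v)
    (hv1 : ∫⁻ x, ‖iteratedFDeriv ℝ 1 v x‖ₑ ^ 2 < ⊤) :
    Integrable (fun x => FluidPDE.frobeniusNormSq (fderiv ℝ v x)) volume := by
  have hDv_eq : ∀ x, ‖fderiv ℝ v x‖ = ‖iteratedFDeriv ℝ 1 v x‖ := fun x => by
    rw [← norm_iteratedFDeriv_fderiv, norm_iteratedFDeriv_zero]
  have l2Dv : ∫⁻ x, ‖fderiv ℝ v x‖ₑ ^ 2 < ⊤ :=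
    lintegral_enorm_sq_lt_top_of_norm_le (fun x => (hDv_eq x).le) hv1
  have lfrob : ∫⁻ x, ENNReal.ofReal (FluidPDE.frobeniusNormSq (fderiv ℝ v x)) < ⊤ :=
    calc ∫⁻ x, ENNReal.ofReal (FluidPDE.frobeniusNormSq (fderiv ℝ v x))
        ≤ ∫⁻ x, 3 * ‖fderiv ℝ v x‖ₑ ^ 2 :=
          lintegral_mono fun x => ofReal_frobeniusNormSq_le_three_mul_enorm_sq _
      _ = 3 * ∫⁻ x, ‖fderiv ℝ v x‖ₑ ^ 2 := lintegral_const_mul' _ _ (by norm_num)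
      _ < ⊤ := ENNReal.mul_lt_top (by norm_num) l2Dv
  exact integrable_of_continuous_of_nonneg (FluidPDE.continuous_frobeniusNormSq_fderiv hv (by simp))
    (fun x => FluidPDE.frobeniusNormSq_nonneg _) lfrob

/-- `det ∇v` is integrable for a `C¹` field with bounded gradient `Dv ∈ L²`. [folklore] -/
private theorem integrable_det_fderiv''
    {v : EuclideanSpace ℝ (Fin 3) → EuclideanSpace ℝ (Fin 3)} (hv : ContDiff ℝ 1 v)
    {B₁ : ℝ} (hB₁ : ∀ x, ‖fderiv ℝ v x‖ ≤ B₁)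
    (hv1 : ∫⁻ x, ‖iteratedFDeriv ℝ 1 v x‖ₑ ^ 2 < ⊤) :
    Integrable (fun x => LinearMap.det
      (fderiv ℝ v x : EuclideanSpace ℝ (Fin 3) →ₗ[ℝ] EuclideanSpace ℝ (Fin 3))) volume := by
  have hdV : ∀ y, DifferentiableAt ℝ v y := fun y => (hv.differentiable (by simp)) y
  have hgc : Continuous fun x => LinearMap.det
      (fderiv ℝ v x : EuclideanSpace ℝ (Fin 3) →ₗ[ℝ] EuclideanSpace ℝ (Fin 3)) := by
    have : (fun x => LinearMap.det
        (fderiv ℝ v x : EuclideanSpace ℝ (Fin 3) →ₗ[ℝ] EuclideanSpace ℝ (Fin 3))) =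
        fun x => (fderiv ℝ v x).det := rfl
    rw [this]
    exact ContinuousLinearMap.continuous_det.comp (hv.continuous_fderiv (by simp))
  refine ((integrable_frobeniusNormSq_fderiv'' hv hv1).const_mul (1 / 2 * B₁)).mono'
    hgc.aestronglyMeasurable (Eventually.of_forall fun y => ?_)
  rw [Real.norm_eq_abs]
  refine (abs_det_fderiv_le'' (hdV y)).trans ?_
  exact mul_le_mul_of_nonneg_right (mul_le_mul_of_nonneg_left (hB₁ y) (by norm_num))
    (FluidPDE.frobeniusNormSq_nonneg _)

/-- **Miller's identity `∫|∇v|²_F = 2∫|S|²_F` as an inequality for the trace density**: for a divergence-free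
`v ∈ C² ∩ L²` with `Dv ∈ L²`, `∫ tr (Dv ∘ Dv) ≤ 0` (in fact `= 0`; from `|Dv|²_F = ‖curl v‖² + tr(Dv ∘ Dv)` pointwise
and the `div`–`curl` estimate `∫|Dv|²_F ≤ ∫‖curl v‖²`; Miller's Hilbert-space isometry `‖S‖² = ‖A‖² = ½‖ω‖² =
½‖∇⊗u‖²`, case `α = 0`). [cite: Miller2019, Prop. 3.1] -/
theorem integral_traceCLM_fderiv_comp_nonpos
    {v : EuclideanSpace ℝ (Fin 3) → EuclideanSpace ℝ (Fin 3)} (hv : ContDiff ℝ 2 v)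
    (hdiv : VectorCalculus.IsDivFree v) (hv0 : ∫⁻ x, ‖v x‖ₑ ^ 2 < ⊤)
    (hv1 : ∫⁻ x, ‖iteratedFDeriv ℝ 1 v x‖ₑ ^ 2 < ⊤) :
    ∫ x, traceCLM ((fderiv ℝ v x).comp (fderiv ℝ v x)) ≤ 0 := by
  have hv1' : ContDiff ℝ 1 v := hv.of_le (by norm_cast)
  have ifrob : Integrable (fun x => FluidPDE.frobeniusNormSq (fderiv ℝ v x)) volume :=
    integrable_frobeniusNormSq_fderiv'' hv1' hv1
  -- `‖curl v‖²` is integrable (`‖curl v x‖ ≤ ‖curlCLM‖ ‖Dv x‖`, `‖Dv‖² ≤ |Dv|²_F`)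
  have hcurlc : Continuous (curl v) := by
    rw [curl_eq_curlCLM_comp]; exact curlCLM.continuous.comp (hv1'.continuous_fderiv one_ne_zero)
  have icurl : Integrable (fun x => ‖curl v x‖ ^ 2) volume := by
    refine (ifrob.const_mul (‖curlCLM‖ ^ 2)).mono' (hcurlc.norm.pow 2).aestronglyMeasurable
      (Eventually.of_forall fun x => ?_)
    rw [Real.norm_of_nonneg (sq_nonneg _)]
    calc ‖curl v x‖ ^ 2 ≤ (‖curlCLM‖ * ‖fderiv ℝ v x‖) ^ 2 :=
          pow_le_pow_left₀ (norm_nonneg _) (norm_curl_le v x) 2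
      _ = ‖curlCLM‖ ^ 2 * ‖fderiv ℝ v x‖ ^ 2 := by ring
      _ ≤ ‖curlCLM‖ ^ 2 * FluidPDE.frobeniusNormSq (fderiv ℝ v x) :=
          mul_le_mul_of_nonneg_left (sq_opNorm_le_frobeniusNormSq _) (sq_nonneg _)
  -- the trace density is `|Dv|²_F − ‖curl v‖²`
  have htr : ∀ x, traceCLM ((fderiv ℝ v x).comp (fderiv ℝ v x)) =
      FluidPDE.frobeniusNormSq (fderiv ℝ v x) - ‖curl v x‖ ^ 2 := fun x => by
    rw [frobeniusNormSq_fderiv_eq_sq_norm_curl_add_trace v x]; ring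
  simp_rw [htr]
  rw [integral_sub ifrob icurl, sub_nonpos]
  -- `∫ |Dv|²_F ≤ ∫ ‖curl v‖²` in `ℝ`, from the `ℝ≥0∞` statement
  have hle := lintegral_frobeniusNormSq_fderiv_le_lintegral_sq_norm_curl hv hdiv hv0
  rw [← ofReal_integral_sq_norm icurl,
    ← ofReal_integral_eq_lintegral_ofReal ifrob
      (Eventually.of_forall fun x => FluidPDE.frobeniusNormSq_nonneg _)] at hle
  exact (ENNReal.ofReal_le_ofReal_iff (integral_nonneg fun x => sq_nonneg _)).1 hle

set_option maxHeartbeats 400000 in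
/-- **The enstrophy production bound by an `L^∞` majorant of the middle principal strain, SHARP constant**
(endpoint `q = ∞` of Miller 2019 Thm 1.1 / Neustupa–Penel 2001 Thm 2).  Let `v : ℝ³ → ℝ³` be smooth and divergence
free, `W : ℝ³ → ℝ³` and `q : ℝ³ → ℝ` be `C¹`, with the momentum equation `W + (v·∇)v = νΔv − ∇q`, `v` and `Dv`
bounded, `v, Dv, D²v, D³v, W, DW, q, Dq ∈ L²`, and let `M₀ ≥ 0` majorise the middle principal strain `λ₂(Dv(x))` at
every `x` (two-frame Courant–Fischer form).  Then `∫ Σᵢ ⟪∂ᵢv, ∂ᵢW⟫ ≤ −ν ∫‖Δv‖² + M₀ ∫ |∇v|²_F`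
(Miller: `⟨−ΔS, (u·∇)S⟩ = −4∫det S ≤ 2∫λ₂⁺|S|² ≤ 2‖λ₂⁺‖_∞ ‖S‖² = ‖λ₂⁺‖_∞ ‖∇u‖²`).
[cite: Miller2019, Thm 1.1 (proof of Thm 5.2), Lemma 5.1, Prop. 3.1] [cite: NeustupaPenel2001, Thm 2] -/
theorem integral_sum_inner_fderiv_le_of_momentum_of_midStrain_le_sharp {ν : ℝ}
    {v W : EuclideanSpace ℝ (Fin 3) → EuclideanSpace ℝ (Fin 3)} {q : EuclideanSpace ℝ (Fin 3) → ℝ}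
    (hv : ContDiff ℝ ∞ v) (hW : ContDiff ℝ 1 W) (hq : ContDiff ℝ 1 q)
    (hmom : ∀ x, W x + FluidPDE.convect v v x = ν • (Δ v) x - gradient q x)
    (hdiv : VectorCalculus.IsDivFree v) {B : ℝ} (hB : ∀ x, ‖v x‖ ≤ B)
    {B₁ : ℝ} (hB₁ : ∀ x, ‖fderiv ℝ v x‖ ≤ B₁)
    {M₀ : ℝ} (hM₀ : 0 ≤ M₀)
    (hmaj : ∀ x, ∃ y z : EuclideanSpace ℝ (Fin 3), ‖y‖ = 1 ∧ ‖z‖ = 1 ∧ ⟪y, z⟫ = 0 ∧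
      ∀ α β : ℝ, ⟪fderiv ℝ v x (α • y + β • z), α • y + β • z⟫ ≤ M₀ * (α ^ 2 + β ^ 2))
    (hv0 : ∫⁻ x, ‖v x‖ₑ ^ 2 < ⊤)
    (hv1 : ∫⁻ x, ‖iteratedFDeriv ℝ 1 v x‖ₑ ^ 2 < ⊤) (hv2 : ∫⁻ x, ‖iteratedFDeriv ℝ 2 v x‖ₑ ^ 2 < ⊤)
    (hv3 : ∫⁻ x, ‖iteratedFDeriv ℝ 3 v x‖ₑ ^ 2 < ⊤)
    (hW0 : ∫⁻ x, ‖W x‖ₑ ^ 2 < ⊤) (hW1 : ∫⁻ x, ‖iteratedFDeriv ℝ 1 W x‖ₑ ^ 2 < ⊤)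
    (hq0 : ∫⁻ x, ‖q x‖ₑ ^ 2 < ⊤) (hq1 : ∫⁻ x, ‖iteratedFDeriv ℝ 1 q x‖ₑ ^ 2 < ⊤) :
    ∫ x, ∑ i, ⟪fderiv ℝ v x (EuclideanSpace.basisFun (Fin 3) ℝ i),
        fderiv ℝ W x (EuclideanSpace.basisFun (Fin 3) ℝ i)⟫ ≤
      -ν * (∫ x, ‖(Δ v) x‖ ^ 2) + M₀ * ∫ x, FluidPDE.frobeniusNormSq (fderiv ℝ v x) := by
  set e := EuclideanSpace.basisFun (Fin 3) ℝ with he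
  have he1 : ∀ i, ‖e i‖ = 1 := fun i => by simp [he]
  have hB0 : 0 ≤ B := (norm_nonneg _).trans (hB 0)
  have hB₁0 : 0 ≤ B₁ := (norm_nonneg _).trans (hB₁ 0)
  -- smoothness and continuity
  have hv3' : ContDiff ℝ 3 v := hv.of_le (by norm_cast)
  have hv2' : ContDiff ℝ 2 v := hv.of_le (by norm_cast)
  have hv1' : ContDiff ℝ 1 v := hv.of_le (by norm_cast)
  have hΔ1 : ContDiff ℝ 1 (Δ v) := contDiff_one_laplacian_of_contDiff_three hv3'
  have cv : Continuous v := hv.continuous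
  have cDv : Continuous (fderiv ℝ v) := hv.continuous_fderiv (by simp)
  have cD2 : Continuous fun x => iteratedFDeriv ℝ 2 v x := hv.continuous_iteratedFDeriv (by norm_cast)
  have cD3 : Continuous fun x => iteratedFDeriv ℝ 3 v x := hv.continuous_iteratedFDeriv (by norm_cast)
  have cdiv : ∀ i, Continuous fun x => fderiv ℝ v x (e i) := fun i => cDv.clm_apply continuous_const
  have cdvs : ∀ j i, Continuous fun x => fderiv ℝ (fun y => fderiv ℝ v y (e j)) x (e i) := fun j i =>
    ((((hv3'.fderiv_right (m := 2) (by norm_num)).clm_apply contDiff_const).continuous_fderiv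
      (by norm_num)).clm_apply continuous_const)
  have cW : Continuous W := hW.continuous
  have cDW : Continuous (fderiv ℝ W) := hW.continuous_fderiv one_ne_zero
  have cdiW : ∀ i, Continuous fun x => fderiv ℝ W x (e i) := fun i => cDW.clm_apply continuous_const
  have cq : Continuous q := hq.continuous
  have cDq : Continuous (fderiv ℝ q) := hq.continuous_fderiv one_ne_zero
  have cdiq : ∀ i, Continuous fun x => fderiv ℝ q x (e i) := fun i => cDq.clm_apply continuous_const
  have cgq : Continuous (gradient q) := by
    have : gradient q = fun x => (InnerProductSpace.toDual ℝ _).symm (fderiv ℝ q x) := rfl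
    rw [this]
    exact (InnerProductSpace.toDual ℝ (EuclideanSpace ℝ (Fin 3))).symm.continuous.comp cDq
  have cΔ : Continuous (Δ v) := hΔ1.continuous
  have cdΔ : ∀ i, Continuous fun x => fderiv ℝ (Δ v) x (e i) := fun i =>
    (hΔ1.continuous_fderiv one_ne_zero).clm_apply continuous_const
  have cconv : Continuous (FluidPDE.convect v v) := cDv.clm_apply cv
  have c3D2 : Continuous fun x => (3 : ℝ) • iteratedFDeriv ℝ 2 v x := cD2.const_smul (3 : ℝ)
  have c3D3 : Continuous fun x => (3 : ℝ) • iteratedFDeriv ℝ 3 v x := cD3.const_smul (3 : ℝ)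
  have cBDv : Continuous fun x => B • fderiv ℝ v x := cDv.const_smul B
  have cF : Continuous fun x => FluidPDE.frobeniusNormSq (fderiv ℝ v x) :=
    FluidPDE.continuous_frobeniusNormSq_fderiv hv1' (by simp)
  have ctr : Continuous fun x => traceCLM ((fderiv ℝ v x).comp (fderiv ℝ v x)) :=
    traceCLM.continuous.comp (((ContinuousLinearMap.compL ℝ (EuclideanSpace ℝ (Fin 3))
      (EuclideanSpace ℝ (Fin 3)) (EuclideanSpace ℝ (Fin 3))).continuous₂).comp (cDv.prodMk cDv))
  -- the weight `φ = λ₂⁺ ∘ Dv`: continuous, `0 ≤ φ ≤ B₁`, `φ ≤ M₀`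
  set φ : EuclideanSpace ℝ (Fin 3) → ℝ := fun x =>
    max (strainEigenvalues (fderiv ℝ v x : EuclideanSpace ℝ (Fin 3) →ₗ[ℝ] EuclideanSpace ℝ (Fin 3))
      finrank_euclideanSpace_fin 1) 0 with hφdef
  have hφc : Continuous φ := (lipschitzWith_midStrain.continuous.comp cDv).max continuous_const
  have hφ0 : ∀ x, 0 ≤ φ x := fun x => le_max_right _ _
  have hφB : ∀ x, φ x ≤ B₁ := fun x =>
    max_le ((midStrain_le_opNorm _).trans (hB₁ x)) ((norm_nonneg _).trans (hB₁ x))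
  have hφm : ∀ x, φ x ≤ M₀ := by
    intro x
    refine max_le ?_ hM₀
    obtain ⟨y, z, hy, hz, hyz, h⟩ := hmaj x
    exact (strainEigenvalues_mid_le_iff
      (fderiv ℝ v x : EuclideanSpace ℝ (Fin 3) →ₗ[ℝ] EuclideanSpace ℝ (Fin 3))
      finrank_euclideanSpace_fin M₀).2 ⟨y, z, hy, hz, hyz, fun α β => by
        simpa only [ContinuousLinearMap.coe_coe] using h α β⟩
  -- the nonnegative density `ψ = |Dv|²_F + tr (Dv ∘ Dv) = 2|S|²_F`, `0 ≤ ψ ≤ 2 |Dv|²_F`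
  set ψ : EuclideanSpace ℝ (Fin 3) → ℝ := fun x =>
    FluidPDE.frobeniusNormSq (fderiv ℝ v x) + traceCLM ((fderiv ℝ v x).comp (fderiv ℝ v x)) with hψdef
  have hψc : Continuous ψ := cF.add ctr
  have hψ0 : ∀ x, 0 ≤ ψ x := fun x => frobeniusNormSq_add_traceCLM_comp_nonneg _
  have hψF : ∀ x, ψ x ≤ 2 * FluidPDE.frobeniusNormSq (fderiv ℝ v x) := fun x => by
    have := traceCLM_comp_le_frobeniusNormSq (fderiv ℝ v x)
    simp only [hψdef]; linarith
  -- pointwise norm bounds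
  have hDv_eq : ∀ x, ‖fderiv ℝ v x‖ = ‖iteratedFDeriv ℝ 1 v x‖ := fun x => by
    rw [← norm_iteratedFDeriv_fderiv, norm_iteratedFDeriv_zero]
  have n_Δ : ∀ x, ‖(Δ v) x‖ ≤ ‖(3 : ℝ) • iteratedFDeriv ℝ 2 v x‖ := fun x => by
    rw [norm_smul, Real.norm_of_nonneg (by norm_num : (0 : ℝ) ≤ 3)]
    exact norm_laplacian_le_three_mul_norm_iteratedFDeriv_two hv2' x
  have n_dΔ : ∀ i x, ‖fderiv ℝ (Δ v) x (e i)‖ ≤ ‖(3 : ℝ) • iteratedFDeriv ℝ 3 v x‖ := fun i x => by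
    rw [norm_smul, Real.norm_of_nonneg (by norm_num : (0 : ℝ) ≤ 3),
      fderiv_laplacian_apply_of_contDiff_three hv3' x (e i)]
    exact (norm_laplacian_le_three_mul_norm_iteratedFDeriv_two
      ((hv3'.fderiv_right (m := 2) (by norm_num)).clm_apply contDiff_const) x).trans
      (mul_le_mul_of_nonneg_left (norm_iteratedFDeriv_fderiv_apply_basisFun_le hv3' 2 (by norm_num) x i)
        (by norm_num))
  have n_conv : ∀ x, ‖FluidPDE.convect v v x‖ ≤ ‖B • fderiv ℝ v x‖ := fun x => by
    rw [FluidPDE.convect, norm_smul, Real.norm_of_nonneg hB0, mul_comm]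
    exact (fderiv ℝ v x).le_opNorm_of_le (hB x)
  have n_gq : ∀ x, ‖gradient q x‖ = ‖iteratedFDeriv ℝ 1 q x‖ := fun x => by
    rw [gradient, LinearIsometryEquiv.norm_map, ← norm_iteratedFDeriv_fderiv, norm_iteratedFDeriv_zero]
  have hin : ∀ i (y : EuclideanSpace ℝ (Fin 3)), ‖⟪e i, y⟫‖ ≤ ‖y‖ := fun i y =>
    (norm_inner_le_norm (𝕜 := ℝ) (e i) y).trans (by rw [he1, one_mul])
  -- finite `L²` norms
  have l2Dv : ∫⁻ x, ‖fderiv ℝ v x‖ₑ ^ 2 < ⊤ :=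
    lintegral_enorm_sq_lt_top_of_norm_le (fun x => (hDv_eq x).le) hv1
  have l2smul3 : ∀ {n : ℕ}, ∫⁻ x, ‖iteratedFDeriv ℝ n v x‖ₑ ^ 2 < ⊤ →
      ∫⁻ x, ‖(3 : ℝ) • iteratedFDeriv ℝ n v x‖ₑ ^ 2 < ⊤ := by
    intro n h
    have : ∀ x, ‖(3 : ℝ) • iteratedFDeriv ℝ n v x‖ₑ ^ 2 =
        ENNReal.ofReal (3 ^ 2) * ‖iteratedFDeriv ℝ n v x‖ₑ ^ 2 := by
      intro x
      rw [enorm_smul, mul_pow, Real.enorm_eq_ofReal (by norm_num : (0:ℝ) ≤ 3),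
        ENNReal.ofReal_pow (by norm_num : (0:ℝ) ≤ 3)]
    simp_rw [this]
    rw [lintegral_const_mul' _ _ ENNReal.ofReal_ne_top]
    exact ENNReal.mul_lt_top ENNReal.ofReal_lt_top h
  have l2Δ : ∫⁻ x, ‖(3 : ℝ) • iteratedFDeriv ℝ 2 v x‖ₑ ^ 2 < ⊤ := l2smul3 hv2
  have l2dΔ : ∫⁻ x, ‖(3 : ℝ) • iteratedFDeriv ℝ 3 v x‖ₑ ^ 2 < ⊤ := l2smul3 hv3
  have l2BDv : ∫⁻ x, ‖B • fderiv ℝ v x‖ₑ ^ 2 < ⊤ := by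
    have : ∀ x, ‖B • fderiv ℝ v x‖ₑ ^ 2 = ‖B‖ₑ ^ 2 * ‖fderiv ℝ v x‖ₑ ^ 2 := fun x => by
      rw [enorm_smul, mul_pow]
    simp_rw [this]
    rw [lintegral_const_mul' _ _ (by simp)]
    exact ENNReal.mul_lt_top (by simp) l2Dv
  have l2gq : ∫⁻ x, ‖gradient q x‖ₑ ^ 2 < ⊤ :=
    lintegral_enorm_sq_lt_top_of_norm_le (fun x => (n_gq x).le) hq1
  have l2diq : ∀ i, ∫⁻ x, ‖fderiv ℝ q x (e i)‖ₑ ^ 2 < ⊤ := fun i =>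
    lintegral_enorm_sq_lt_top_of_norm_le (fun x => norm_fderiv_apply_basisFun_le q x i) hq1
  have l2div : ∀ i, ∫⁻ x, ‖fderiv ℝ v x (e i)‖ₑ ^ 2 < ⊤ := fun i =>
    lintegral_enorm_sq_lt_top_of_norm_le (fun x => by
      simpa [he1] using (fderiv ℝ v x).le_opNorm (e i)) l2Dv
  have l2diW : ∀ i, ∫⁻ x, ‖fderiv ℝ W x (e i)‖ₑ ^ 2 < ⊤ := fun i =>
    lintegral_enorm_sq_lt_top_of_norm_le (fun x => norm_fderiv_apply_basisFun_le W x i) hW1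
  have l2ddv : ∀ i, ∫⁻ x, ‖fderiv ℝ (fun y => fderiv ℝ v y (e i)) x (e i)‖ₑ ^ 2 < ⊤ := fun i =>
    lintegral_enorm_sq_lt_top_of_norm_le (fun x => norm_fderiv_fderiv_apply_basisFun_le hv2' x i) hv2
  -- integrability of the products
  have i1 : ∀ i, Integrable (fun x => ⟪fderiv ℝ (fun y => fderiv ℝ v y (e i)) x (e i), W x⟫)
      volume := fun i =>
    integrable_of_norm_le_mul_of_lintegral_sq ((cdvs i i).inner cW).aestronglyMeasurable (cdvs i i) cW
      (l2ddv i) hW0 fun x => norm_inner_le_norm _ _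
  have i2 : ∀ i, Integrable (fun x => ⟪fderiv ℝ v x (e i), fderiv ℝ W x (e i)⟫) volume := fun i =>
    integrable_of_norm_le_mul_of_lintegral_sq ((cdiv i).inner (cdiW i)).aestronglyMeasurable
      (cdiv i) (cdiW i) (l2div i) (l2diW i) fun x => norm_inner_le_norm _ _
  have i3 : ∀ i, Integrable (fun x => ⟪fderiv ℝ v x (e i), W x⟫) volume := fun i =>
    integrable_of_norm_le_mul_of_lintegral_sq ((cdiv i).inner cW).aestronglyMeasurable (cdiv i) cW
      (l2div i) hW0 fun x => norm_inner_le_norm _ _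
  have iΔΔ : Integrable (fun x => ‖(Δ v) x‖ ^ 2) volume :=
    FluidPDE.integrable_sq_norm_of_lintegral_lt_top cΔ (lintegral_enorm_sq_lt_top_of_norm_le n_Δ l2Δ)
  have iΔg : Integrable (fun x => ⟪(Δ v) x, gradient q x⟫) volume :=
    integrable_of_norm_le_mul_of_lintegral_sq (cΔ.inner cgq).aestronglyMeasurable c3D2 cgq
      l2Δ l2gq fun x => (norm_inner_le_norm _ _).trans
        (mul_le_mul_of_nonneg_right (n_Δ x) (norm_nonneg _))
  have iΔc : Integrable (fun x => ⟪(Δ v) x, FluidPDE.convect v v x⟫) volume :=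
    integrable_of_norm_le_mul_of_lintegral_sq (cΔ.inner cconv).aestronglyMeasurable c3D2 cBDv
      l2Δ l2BDv fun x => (norm_inner_le_norm _ _).trans
        (mul_le_mul (n_Δ x) (n_conv x) (norm_nonneg _) (norm_nonneg _))
  have ifrob : Integrable (fun x => FluidPDE.frobeniusNormSq (fderiv ℝ v x)) volume :=
    integrable_frobeniusNormSq_fderiv'' hv1' hv1
  have idet : Integrable (fun x => LinearMap.det
      (fderiv ℝ v x : EuclideanSpace ℝ (Fin 3) →ₗ[ℝ] EuclideanSpace ℝ (Fin 3))) volume :=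
    integrable_det_fderiv'' hv1' hB₁ hv1
  have itr : Integrable (fun x => traceCLM ((fderiv ℝ v x).comp (fderiv ℝ v x))) volume := by
    refine ifrob.mono' ctr.aestronglyMeasurable (Eventually.of_forall fun x => ?_)
    rw [Real.norm_eq_abs, abs_le]
    have h1 := traceCLM_comp_le_frobeniusNormSq (fderiv ℝ v x)
    have h2 := frobeniusNormSq_add_traceCLM_comp_nonneg (fderiv ℝ v x)
    constructor <;> linarith
  have iψ : Integrable ψ volume := ifrob.add itr
  have i_φψ : Integrable (fun x => φ x * ψ x) volume := by
    have hdom : Integrable (fun x => B₁ * (2 * FluidPDE.frobeniusNormSq (fderiv ℝ v x))) volume :=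
      (ifrob.const_mul _).const_mul _
    refine hdom.mono' (hφc.mul hψc).aestronglyMeasurable (Eventually.of_forall fun x => ?_)
    rw [Real.norm_of_nonneg (mul_nonneg (hφ0 x) (hψ0 x))]
    exact mul_le_mul (hφB x) (hψF x) (hψ0 x) hB₁0
  have i_Tj : ∀ j, Integrable (fun x => ⟪fderiv ℝ v x (e j), fderiv ℝ v x (fderiv ℝ v x (e j))⟫)
      volume := by
    intro j
    have i_a : Integrable (fun x => ‖fderiv ℝ v x (e j)‖ ^ 2) volume :=
      FluidPDE.integrable_sq_norm_of_lintegral_lt_top (cdiv j) (l2div j)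
    have hdom : Integrable (fun x => B₁ * ‖fderiv ℝ v x (e j)‖ ^ 2) volume := i_a.const_mul _
    refine hdom.mono' ((cdiv j).inner (cDv.clm_apply (cdiv j))).aestronglyMeasurable
      (Eventually.of_forall fun x => ?_)
    calc ‖⟪fderiv ℝ v x (e j), fderiv ℝ v x (fderiv ℝ v x (e j))⟫‖
        ≤ ‖fderiv ℝ v x (e j)‖ * ‖fderiv ℝ v x (fderiv ℝ v x (e j))‖ := norm_inner_le_norm _ _
      _ ≤ ‖fderiv ℝ v x (e j)‖ * (B₁ * ‖fderiv ℝ v x (e j)‖) :=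
          mul_le_mul_of_nonneg_left ((fderiv ℝ v x).le_of_opNorm_le (hB₁ x) _) (norm_nonneg _)
      _ = B₁ * ‖fderiv ℝ v x (e j)‖ ^ 2 := by ring
  -- Step 1: `∫ Σᵢ ⟪∂ᵢv, ∂ᵢW⟫ = -∫ ⟪Δv, W⟫`
  have hL := integral_sum_inner_fderiv_fderiv_eq_neg_integral_inner_laplacian hv2' hW i1 i2 i3
  -- Step 2: the pressure term vanishes
  have hpress : ∫ x, ⟪(Δ v) x, gradient q x⟫ = 0 := by
    have hswap : (fun x => ⟪(Δ v) x, gradient q x⟫) = fun x => ⟪gradient q x, (Δ v) x⟫ :=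
      funext fun x => real_inner_comm _ _
    rw [hswap]
    refine integral_inner_gradient_eq_zero_of_isDivFree_R3 hq hΔ1
      (isDivFree_laplacian_of_contDiff_three hv3' hdiv) (fun i => ?_) (fun i => ?_) (fun i => ?_)
    · refine integrable_of_norm_le_mul_of_lintegral_sq
        ((continuous_const.inner cΔ).mul (cdiq i)).aestronglyMeasurable c3D2 (cdiq i) l2Δ (l2diq i)
        fun x => ?_
      rw [norm_mul]
      exact mul_le_mul ((hin i _).trans (n_Δ x)) le_rfl (norm_nonneg _) (norm_nonneg _)
    · refine integrable_of_norm_le_mul_of_lintegral_sq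
        ((continuous_const.inner (cdΔ i)).mul cq).aestronglyMeasurable c3D3 cq l2dΔ hq0
        fun x => ?_
      rw [norm_mul]
      exact mul_le_mul ((hin i _).trans (n_dΔ i x)) le_rfl (norm_nonneg _) (norm_nonneg _)
    · refine integrable_of_norm_le_mul_of_lintegral_sq
        ((continuous_const.inner cΔ).mul cq).aestronglyMeasurable c3D2 cq l2Δ hq0
        fun x => ?_
      rw [norm_mul]
      exact mul_le_mul ((hin i _).trans (n_Δ x)) le_rfl (norm_nonneg _) (norm_nonneg _)
  -- Step 3: the pointwise identity `-⟪Δv, W⟫ = -ν‖Δv‖² + ⟪Δv, (v·∇)v⟫ + ⟪Δv, ∇q⟫`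
  have hpt : ∀ x, -⟪(Δ v) x, W x⟫ =
      -ν * ‖(Δ v) x‖ ^ 2 + ⟪(Δ v) x, FluidPDE.convect v v x⟫ + ⟪(Δ v) x, gradient q x⟫ := by
    intro x
    have hWx : W x = ν • (Δ v) x - FluidPDE.convect v v x - gradient q x := by
      have h : W x = ν • (Δ v) x - gradient q x - FluidPDE.convect v v x :=
        eq_sub_iff_add_eq.2 (hmom x)
      rw [h]; abel
    rw [hWx, inner_sub_right, inner_sub_right, inner_smul_right, real_inner_self_eq_norm_sq]
    ring
  -- Step 4: integrate
  have iA : Integrable (fun x => -ν * ‖(Δ v) x‖ ^ 2) volume := iΔΔ.const_mul _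
  have iAB : Integrable (fun x => -ν * ‖(Δ v) x‖ ^ 2 + ⟪(Δ v) x, FluidPDE.convect v v x⟫) volume :=
    iA.add iΔc
  have hint : ∫ x, -⟪(Δ v) x, W x⟫ =
      -ν * (∫ x, ‖(Δ v) x‖ ^ 2) + (∫ x, ⟪(Δ v) x, FluidPDE.convect v v x⟫) +
        ∫ x, ⟪(Δ v) x, gradient q x⟫ := by
    rw [integral_congr_ae (Eventually.of_forall hpt), integral_add iAB iΔg, integral_add iA iΔc,
      integral_const_mul]
  have hneg_int : ∫ x, -⟪(Δ v) x, W x⟫ = - ∫ x, ⟪(Δ v) x, W x⟫ := integral_neg _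
  -- Step 5: the trilinear term, bounded SHARPLY by the middle principal strain (Miller's Lemma 5.1)
  have htri : ∫ x, ⟪(Δ v) x, FluidPDE.convect v v x⟫ ≤ ∫ x, φ x * ψ x := by
    rw [integral_inner_laplacian_convect_eq_neg_sum hv3' hdiv hB hB₁ hv1 hv2,
      ← integral_finsetSum _ fun j _ => i_Tj j, ← integral_neg]
    have hdet0 := integral_det_fderiv_eq_zero hv hB hB₁ hv1
    have hup : ∫ x, φ x * ψ x =
        ∫ x, (φ x * ψ x +
          LinearMap.det (fderiv ℝ v x : EuclideanSpace ℝ (Fin 3) →ₗ[ℝ] EuclideanSpace ℝ (Fin 3))) := by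
      rw [integral_add i_φψ idet, hdet0, add_zero]
    rw [hup]
    refine integral_mono (integrable_finsetSum _ fun j _ => i_Tj j).neg (i_φψ.add idet) fun x => ?_
    simp only
    have h := neg_sum_inner_apply_apply_le_midStrain_sharp (fderiv ℝ v x) (hdiv x)
    simpa only [hφdef, hψdef] using h
  -- Step 6: `∫ φ ψ ≤ M₀ ∫ ψ = M₀ (∫ |∇v|²_F + ∫ tr (Dv ∘ Dv)) ≤ M₀ ∫ |∇v|²_F`
  have hkey : ∫ x, φ x * ψ x ≤ M₀ * ∫ x, FluidPDE.frobeniusNormSq (fderiv ℝ v x) := by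
    have h1 : ∫ x, φ x * ψ x ≤ M₀ * ∫ x, ψ x := by
      rw [← integral_const_mul]
      exact integral_mono i_φψ (iψ.const_mul _) fun x =>
        mul_le_mul_of_nonneg_right (hφm x) (hψ0 x)
    have h2 : ∫ x, ψ x ≤ ∫ x, FluidPDE.frobeniusNormSq (fderiv ℝ v x) := by
      simp only [hψdef]
      rw [integral_add ifrob itr]
      linarith [integral_traceCLM_fderiv_comp_nonpos hv2' hdiv hv0 hv1]
    exact h1.trans (mul_le_mul_of_nonneg_left h2 hM₀)
  -- Step 7: conclude
  rw [hL, ← hneg_int, hint, hpress, add_zero]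
  linarith [htri, hkey]

end Literature.Analysis.FluidPDE

end
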